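import Literature.IUT.HodgeArakelov.MonoThetaProp13Sub
import HarnessLib

/-!
# [IUTchII] Prop 1.3 (ii)/(iii) sub-node r2 («the [AbsTopIII] Cor 1.10 (c) isomorphism is conventional») AS TYPED:
# characterisation and the exact-name instance witness (FACT-LIST F-2780 `Prop13Sub.Cor110cNatural`)

S. Mochizuki, *Inter-universal Teichmüller theory II*, §1, Proposition 1.3 (ii)/(iii), kurims manuscript
(Dec. 2020) p. 26 (statement of (ii): «the natural isomorphism `μ_Ẑ(G_k) ⥲ μ_Ẑ(Π_X)` of [AbsTopIII],
Corollary 1.10, (c)») and p. 27 l. 1–7 (proof of (iii)); [AbsTopIII] Cor. 1.10 (c) p. 41.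

Cell `abc-iut`, seat abc-iut-c312-2 (K-census owner; L6 node IUTchII:Prop1.3(iii), K4 class BLOCKED).  PROOF-ONLY
companion (no `def`, no `instance`, no notation) of abc-iut-L6's `MonoThetaProp13Sub.lean`.  Of the four
«conventional identification» sub-nodes r2/r3/r4a/r4b of Prop. 1.3 (ii) — all four hold at the TAUTOLOGICAL gauge
`κ := ConventionalCyclotomes.ofBsGal B` by abc-iut-w5-d064's `subnodes_ofBsGal` — the tree exposes r3, r4a, r4b with
the FACT row's declaration as conclusion head (`rmk321Natural_ofBsGal`, `corrMuNConventional_ofBsGal`,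
`corrIntSConventional_ofBsGal`), but NOT r2: the K-census of record (abc-iut-c312-2 c87, CONE-FACT-PRODUCERS.tsv)
lists F-2780 `Cor110cNatural` as the ONE assumption-class FACT row of the cone with NO producer at all.  This file
supplies the missing exact-name witness and the characterisation, in the shape of its three siblings:

* `Prop13Sub.cor110cNatural_iff` — r2 holds iff the field `κ.idG` IS the composite
  `μ_Ẑ(G_k) ⊗ ℤ/Nℤ →[corGk_PiX] μ_Ẑ(Π_X) ⊗ ℤ/Nℤ →[κ.idPiX] ν` (it pins one field of the binder `κ`);
* `Prop13Sub.cor110cNatural_ofBsGal` — **exact-name instance witness for F-2780** (first conjunct of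
  `subnodes_ofBsGal`): at the tautological gauge the clause holds for EVERY typed Prop. 1.3 (ii) datum `B`;
(The NEG side is already in the tree and is NOT restated: `not_cor110cNatural_regauge` / `not_forall_cor110cNatural`
in `Prop13SubClosedUniversalClosures.lean` — re-gauging `κ.idG` alone kills r2, so the clause is a constraint on the
binder `κ`, not a property of the datum `(Z, B)`.)

HONEST FRAMING: the tautological gauge carries no arithmetic content (print's content of r2 is that the scheme-theoretic
identification agrees with the group-theoretic one of [AbsTopIII] Cor. 1.10 (c) at the genuine `Π_X`, which the tree
does not construct); an instance at OUR typed datum ≠ a theorem about print; nothing here bears on [IUTchIII] Cor. 3.12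
(no side taken); typed ≠ proved; count-neutral for the cone headline.
-/

namespace Literature.IUT.HodgeArakelov

universe u w

open Literature.AnabelianGeometry.EtaleTheta

namespace Prop13Sub

variable {S : ThetaSetting.{u}} {F : TemperedFrobenioidData S} {E : EnvOfFrobenioid F}
  {Z : FrobenioidCyclotomes E} {B : BsGalData Z} {ν : Type w} [Group ν]

/-- **r2 characterised** ([IUTchII] Prop. 1.3 (ii) p. 26, «the natural isomorphism `μ_Ẑ(G_k) ⥲ μ_Ẑ(Π_X)` of
[AbsTopIII], Corollary 1.10, (c)», read as conventional under `κ`): the clause holds iff the field `κ.idG` IS the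
composite `μ_Ẑ(G_k) ⊗ ℤ/Nℤ →[corGk_PiX] μ_Ẑ(Π_X) ⊗ ℤ/Nℤ →[κ.idPiX] ν` — it pins one field of the binder `κ`.
[claim: Mochizuki2012, status: disputed] (IUTchII §1 Prop 1.3 (ii), kurims p.26; [AbsTopIII] Cor 1.10 (c)) -/
theorem cor110cNatural_iff (κ : ConventionalCyclotomes Z B ν) :
    Cor110cNatural κ ↔ κ.idG = B.corGk_PiX.trans κ.idPiX := by
  constructor
  · intro h
    ext y
    rw [MulEquiv.trans_apply]
    exact (h y).symm
  · intro h y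
    rw [h, MulEquiv.trans_apply]

/-- **Exact-name instance witness for F-2780** (r2 at the tautological `κ := ConventionalCyclotomes.ofBsGal B`,
abc-iut-w5-d064's `subnodes_ofBsGal`, first conjunct): the clause is inhabited at every typed Prop. 1.3 (ii) datum.
[claim: Mochizuki2012, status: disputed] (IUTchII §1 Prop 1.3 (ii), kurims p.26; [AbsTopIII] Cor 1.10 (c)) -/
theorem cor110cNatural_ofBsGal (B : BsGalData Z) : Cor110cNatural (ConventionalCyclotomes.ofBsGal B) :=
  (subnodes_ofBsGal B).1

end Prop13Sub

end Literature.IUT.HodgeArakelov
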